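import Literature.NumberTheory.GaloisRepresentations.ContinuousCohomologyConnecting
import HarnessLib

/-!
# Connecting classes `H¹ → H²` in cochain form for arbitrary coefficients: continuous `2`-cocycles
# presented as coboundaries in an ambient module

Topic `Literature/NumberTheory/GaloisRepresentations`; sequel to `ContinuousCohomologyConnecting` (which
treats short exact sequences of DISCRETE modules). One definition (a `Prop`-valued predicate) and its
elementary theory; no named fact, no instance, no `sorry`.

## The situation

Let `Γ` be a topological group, `ρ : Γ → GL(M)` a continuous representation on a topological module `M`
(the tree's `ContinuousRep`, jointly continuous action; e.g. `M = ℤ_p(1)` or `ℚ_p(1)`), and let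
`ι : M ↪ B` be an injective `Γ`-equivariant additive map into an AMBIENT `Γ`-module `B` on which NO topology
is used (a Mathlib `Representation S Γ B`; e.g. `B = B_dR⁺ ⊗ V`, Kato's `X = B_crys^{φ=p} ∩ B_dR⁺`, `ℂ_p(1)`,
a ring of periods). A continuous inhomogeneous `2`-cocycle `c : Γ × Γ → M` (`contTwoCocycles`,
`ContinuousH2.lean`) is **presented as a coboundary in `B` by a cochain `f : Γ → B`** when

  `ι (c(σ, τ)) = σ f(τ) - f(στ) + f(σ)`  for all `σ, τ`            (`IsCoboundaryLift π ι f c`).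

Equivalently, `f` is a `1`-cochain of `B` whose image in `B/ι(M)` is a `1`-cocycle, and `c` is the value ON
COCHAINS of the connecting homomorphism `δ : H¹(Γ, B/M) → H²(Γ, M)` at that cocycle: lift, take the
coboundary, pull back along `ι` (Neukirch–Schmidt–Wingberg, *Cohomology of Number Fields*, I §3, proof of
(1.3.2); for continuous cochains of topological modules Tate, *Relations between K₂ and Galois
cohomology* (1976), §2, and II §7 of NSW). For non-discrete coefficients (`B_dR⁺`-modules, `ℂ_p(i)`) a
continuous set-theoretic section of `B → B/M` is not available in general, so the connecting map is not a
priori defined on all of `H¹(Γ, B/M)`; but every argument "by a formal computation on cochains" (e.g.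
Kato, LNM 1553, Ch. II, proof of Lemma 1.4.3: `exp(a) ∪ b = δ(⟨a, exp* b⟩ · log χ)`) only ever uses
classes of EXPLICITLY LIFTED cochains, for which this file provides the calculus:

* `IsCoboundaryLift.unique` — `c` is determined by `f` (`ι` injective);
* closure under `0`, `+`, `-`, adding `ι ∘ h` for a continuous `h : Γ → M` (the cocycle changes by the
  coboundary `∂h`, `IsCoboundaryLift.add_twoCoboundary`) and adding a `1`-cocycle of `B`
  (`IsCoboundaryLift.add_cocycle`);
* ★ `IsCoboundaryLift.twoCocycleClass_eq` — **independence of the lift up to `ι ∘ C(Γ, M) + Z¹(Γ, B)`**: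
  if `f' = f + ι ∘ h + z` with `h` continuous and `z` a cocycle then `[c'] = [c]` in `H²_cont(Γ, M)`;
* ★ `IsCoboundaryLift.twoCocycleClass_eq_zero_iff` — **exactness at `H²`**: `[c] = 0` iff
  `f = ι ∘ h + z` with `h : Γ → M` continuous and `z` a `1`-cocycle of `B` (so that a vanishing theorem for
  the relevant cocycles of `B` makes `f ≡ ι ∘ h` modulo coboundaries: exactness at `H¹(Γ, B/M)`);
* functoriality: change of ambient module (`IsCoboundaryLift.map`), and pull-back along a compatible pair
  `(θ : Γ' → Γ, φ : M → M')` (`IsCoboundaryLift.pullback`, matching the tree's `contTwoCocycles.pullback` /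
  `map_twoCocycleClass`);
* the link with a quotient map `g : B → C` with `ker g = ι(M)`: `g ∘ f` is a crossed homomorphism iff the
  coboundary of `f` lies in `ι(M)` pointwise (`coboundary_mem_range_iff_comp_isCocycle`), and cohomologous
  push-forwards have lifts differing by `ι ∘ h + ∂b₀` (`exists_sub_sub_coboundary_mem_range`);
* the topological supplement: when `B` does carry a topology for which `ι` is an embedding, a continuous
  `B`-valued function with values in `ι(M)` is `ι ∘ h` with `h` CONTINUOUS
  (`exists_continuousMap_comp_eq_of_isInducing`), whence the class equality for continuous lifts
  (`IsCoboundaryLift.twoCocycleClass_eq_of_continuous`).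

The companion file `ContinuousCupProductCoboundaryLift` produces such presentations from cup products
`a ∪ b` one of whose factors becomes a coboundary in an ambient module (Kato's "formal argument").

## References
* J. Neukirch, A. Schmidt, K. Wingberg, *Cohomology of Number Fields*, 2nd ed. (2008), I §3 (1.3.2) (the
  connecting homomorphism on cochains), II §7 (continuous cochains). [NeukirchSchmidtWingberg2008]
* J. Tate, *Relations between K₂ and Galois cohomology*, Invent. Math. 36 (1976), §2. [Tate1976K2]
* K. Kato, *Lectures on the approach to Iwasawa theory for Hasse–Weil L-functions via B_dR, I*, LNM 1553
  (1993), Ch. II Lemma 1.4.3 (the consumer). [Kato1993LNM1553]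
-/

noncomputable section

open CategoryTheory Function Topology

universe u

namespace Literature.NumberTheory.GaloisRepresentations

open _root_.TopRep _root_.ContRepresentation _root_.ContinuousCohomology

/-! ### The predicate -/

section Defs

variable {R : Type*} [CommRing R] [TopologicalSpace R]
variable {Γ : Type u} [Group Γ] [TopologicalSpace Γ]
variable {M : Type u} [AddCommGroup M] [Module R M] [TopologicalSpace M] [IsTopologicalAddGroup M]
  [ContinuousSMul R M]
variable {ρ : ContinuousRep Γ R M}
variable {S : Type*} [CommSemiring S] {B : Type*} [AddCommGroup B] [Module S B]

/-- **`f : Γ → B` presents the continuous `2`-cocycle `c : Γ × Γ → M` as a coboundary in the ambient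
`Γ`-module `B`, through `ι : M → B`**: `ι (c(σ, τ)) = σ f(τ) - f(στ) + f(σ)` for all `σ, τ ∈ Γ` — the
inhomogeneous coboundary of the `1`-cochain `f` of `B` is `ι ∘ c`. This is the cochain-level content of the
connecting homomorphism `H¹(Γ, B/M) → H²(Γ, M)` evaluated at the cocycle `f mod M`.
[cite: NeukirchSchmidtWingberg2008, I §3 (1.3.2), II §7] [cite: Tate1976K2, §2] -/
def IsCoboundaryLift (π : Representation S Γ B) (ι : M →+ B) (f : Γ → B)
    (c : contTwoCocycles ρ.toTopRep) : Prop :=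
  ∀ σ τ : Γ, ι (c.1 (σ, τ)) = π σ (f τ) - f (σ * τ) + f σ

/-- Unfolding `IsCoboundaryLift`. [cite: NeukirchSchmidtWingberg2008, I §3 (1.3.2), II §7] -/
theorem isCoboundaryLift_iff (π : Representation S Γ B) (ι : M →+ B) (f : Γ → B)
    (c : contTwoCocycles ρ.toTopRep) :
    IsCoboundaryLift π ι f c ↔ ∀ σ τ : Γ, ι (c.1 (σ, τ)) = π σ (f τ) - f (σ * τ) + f σ :=
  Iff.rfl

end Defs

namespace IsCoboundaryLift

/-! ### Algebra of coboundary presentations -/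

section Algebra

variable {R : Type*} [CommRing R] [TopologicalSpace R]
variable {Γ : Type u} [Group Γ] [TopologicalSpace Γ]
variable {M : Type u} [AddCommGroup M] [Module R M] [TopologicalSpace M] [IsTopologicalAddGroup M]
  [ContinuousSMul R M]
variable {ρ : ContinuousRep Γ R M}
variable {S : Type*} [CommSemiring S] {B : Type*} [AddCommGroup B] [Module S B]
variable {π : Representation S Γ B} {ι : M →+ B}

/-- **The cocycle is determined by the presenting cochain** (`ι` injective). [cite: NeukirchSchmidtWingberg2008, I §3 (1.3.2), II §7] -/
theorem unique (hinj : Injective ι) {f : Γ → B} {c c' : contTwoCocycles ρ.toTopRep}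
    (hc : IsCoboundaryLift π ι f c) (hc' : IsCoboundaryLift π ι f c') : c = c' :=
  Subtype.ext (ContinuousMap.ext fun p => by
    obtain ⟨σ, τ⟩ := p
    exact hinj ((hc σ τ).trans (hc' σ τ).symm))

/-- Transport along pointwise equal cochains. [cite: NeukirchSchmidtWingberg2008, I §3 (1.3.2), II §7] -/
theorem congr {f f' : Γ → B} {c : contTwoCocycles ρ.toTopRep} (hc : IsCoboundaryLift π ι f c)
    (e : ∀ σ, f' σ = f σ) : IsCoboundaryLift π ι f' c := fun σ τ => by
  rw [e, e, e]; exact hc σ τ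

variable (π ι) in
/-- The zero cochain presents the zero cocycle. [cite: NeukirchSchmidtWingberg2008, I §3 (1.3.2), II §7] -/
theorem zero : IsCoboundaryLift π ι (0 : Γ → B) (0 : contTwoCocycles ρ.toTopRep) := fun σ τ => by
  simp

/-- Sums of presentations. [cite: NeukirchSchmidtWingberg2008, I §3 (1.3.2), II §7] -/
theorem add {f f' : Γ → B} {c c' : contTwoCocycles ρ.toTopRep} (hc : IsCoboundaryLift π ι f c)
    (hc' : IsCoboundaryLift π ι f' c') : IsCoboundaryLift π ι (f + f') (c + c') := fun σ τ => by
  change ι (c.1 (σ, τ) + c'.1 (σ, τ)) = _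
  simp only [map_add, hc σ τ, hc' σ τ, Pi.add_apply]
  abel

/-- Negatives of presentations. [cite: NeukirchSchmidtWingberg2008, I §3 (1.3.2), II §7] -/
theorem neg {f : Γ → B} {c : contTwoCocycles ρ.toTopRep} (hc : IsCoboundaryLift π ι f c) :
    IsCoboundaryLift π ι (-f) (-c) := fun σ τ => by
  change ι (-c.1 (σ, τ)) = _
  simp only [map_neg, hc σ τ, Pi.neg_apply]
  abel

/-- Differences of presentations. [cite: NeukirchSchmidtWingberg2008, I §3 (1.3.2), II §7] -/
theorem sub {f f' : Γ → B} {c c' : contTwoCocycles ρ.toTopRep} (hc : IsCoboundaryLift π ι f c)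
    (hc' : IsCoboundaryLift π ι f' c') : IsCoboundaryLift π ι (f - f') (c - c') := by
  rw [sub_eq_add_neg, sub_eq_add_neg]; exact hc.add hc'.neg

/-- **Adding a `1`-cocycle of the ambient module does not change the cocycle**: if
`z(στ) = z(σ) + σ z(τ)` then `f + z` presents the same `c`. [cite: NeukirchSchmidtWingberg2008, I §3 (1.3.2), II §7] -/
theorem add_cocycle {f : Γ → B} {c : contTwoCocycles ρ.toTopRep} (hc : IsCoboundaryLift π ι f c)
    {z : Γ → B} (hz : ∀ σ τ, z (σ * τ) = z σ + π σ (z τ)) :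
    IsCoboundaryLift π ι (f + z) c := fun σ τ => by
  simp only [Pi.add_apply, hc σ τ, hz σ τ, map_add]
  abel

/-- In particular adding an algebraic coboundary `σ ↦ σ b₀ - b₀` of `B` does not change the cocycle.
[cite: NeukirchSchmidtWingberg2008, I §3 (1.3.2), II §7] -/
theorem add_coboundary {f : Γ → B} {c : contTwoCocycles ρ.toTopRep} (hc : IsCoboundaryLift π ι f c)
    (b₀ : B) : IsCoboundaryLift π ι (fun σ => f σ + (π σ b₀ - b₀)) c :=
  hc.add_cocycle (z := fun σ => π σ b₀ - b₀) fun σ τ => by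
    rw [map_mul, Module.End.mul_apply, map_sub]; abel

variable [IsTopologicalGroup Γ]

/-- **Adding `ι ∘ h` for a CONTINUOUS `h : Γ → M` changes the cocycle by the coboundary `∂h`**
(`ContinuousRep.twoCoboundary`; `ι` equivariant). [cite: NeukirchSchmidtWingberg2008, I §3 (1.3.2), II §7] -/
theorem add_twoCoboundary (hι : ∀ (σ : Γ) (x : M), ι (ρ σ x) = π σ (ι x)) {f : Γ → B}
    {c : contTwoCocycles ρ.toTopRep} (hc : IsCoboundaryLift π ι f c) (h : C(Γ, M)) :
    IsCoboundaryLift π ι (fun σ => f σ + ι (h σ)) (c + ρ.twoCoboundary h) := fun σ τ => by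
  change ι (c.1 (σ, τ) + (ρ.twoCoboundary h).1 (σ, τ)) = _
  rw [ContinuousRep.twoCoboundary_apply]
  simp only [map_add, map_sub, hc σ τ, hι]
  abel

variable [LocallyCompactSpace Γ]

/-- ★ **Independence of the lift, up to `ι ∘ C(Γ, M) + Z¹(Γ, B)`.** If `f` presents `c`, `f'` presents `c'`
and `f' = f + ι ∘ h + z` with `h : Γ → M` continuous and `z` a `1`-cocycle of `B`, then `[c'] = [c]` in
`H²_cont(Γ, M)` (indeed `c' = c + ∂h`). This is the well-definedness of the connecting homomorphism
`H¹(Γ, B/M) → H²(Γ, M)` on classes of lifted cochains.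
Ref: Neukirch–Schmidt–Wingberg (2008), I §3 (1.3.2); Tate (1976) §2. [cite: NeukirchSchmidtWingberg2008, I §3 (1.3.2)] -/
theorem twoCocycleClass_eq (hι : ∀ (σ : Γ) (x : M), ι (ρ σ x) = π σ (ι x)) (hinj : Injective ι)
    {f f' : Γ → B} {c c' : contTwoCocycles ρ.toTopRep} (hc : IsCoboundaryLift π ι f c)
    (hc' : IsCoboundaryLift π ι f' c') (h : C(Γ, M)) (z : Γ → B)
    (hz : ∀ σ τ, z (σ * τ) = z σ + π σ (z τ)) (e : ∀ σ, f' σ = f σ + ι (h σ) + z σ) :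
    twoCocycleClass ρ.toTopRep c' = twoCocycleClass ρ.toTopRep c := by
  have h1 : IsCoboundaryLift π ι f' (c + ρ.twoCoboundary h) :=
    ((hc.add_twoCoboundary hι h).add_cocycle hz).congr fun σ => by rw [Pi.add_apply, e]
  rw [hc'.unique hinj h1, twoCocycleClass_add, ContinuousRep.twoCocycleClass_twoCoboundary, add_zero]

/-- Special case: lifts differing by `ι ∘ h`, `h` continuous, give the same class. [cite: NeukirchSchmidtWingberg2008, I §3 (1.3.2), II §7] -/
theorem twoCocycleClass_eq_of_sub_eq_comp (hι : ∀ (σ : Γ) (x : M), ι (ρ σ x) = π σ (ι x))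
    (hinj : Injective ι) {f f' : Γ → B} {c c' : contTwoCocycles ρ.toTopRep}
    (hc : IsCoboundaryLift π ι f c) (hc' : IsCoboundaryLift π ι f' c') (h : C(Γ, M))
    (e : ∀ σ, f' σ - f σ = ι (h σ)) :
    twoCocycleClass ρ.toTopRep c' = twoCocycleClass ρ.toTopRep c :=
  hc.twoCocycleClass_eq hι hinj hc' h 0 (fun _ _ => by simp) fun σ => by
    rw [Pi.zero_apply, add_zero, ← e, add_sub_cancel]

/-- Special case: lifts differing by a `1`-cocycle of `B` give the same cocycle, hence the same class.
[cite: NeukirchSchmidtWingberg2008, I §3 (1.3.2), II §7] -/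
theorem twoCocycleClass_eq_of_sub_cocycle (hinj : Injective ι) {f f' : Γ → B}
    {c c' : contTwoCocycles ρ.toTopRep} (hc : IsCoboundaryLift π ι f c)
    (hc' : IsCoboundaryLift π ι f' c') (hz : ∀ σ τ, (f' - f) (σ * τ) = (f' - f) σ + π σ ((f' - f) τ)) :
    twoCocycleClass ρ.toTopRep c' = twoCocycleClass ρ.toTopRep c := by
  rw [hc'.unique hinj ((hc.add_cocycle hz).congr fun σ => by simp)]

/-- ★ **Exactness at `H²`: a presented cocycle has trivial class iff its lift is `ι ∘ h` plus a cocycle of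
`B`, `h : Γ → M` continuous.** `[c] = 0 ↔ ∃ h : C(Γ, M), (f - ι ∘ h)` is a `1`-cocycle of `B`. (With a
vanishing theorem for such cocycles of `B` this is the exactness of
`H¹(Γ, B) → H¹(Γ, B/M) → H²(Γ, M)` at the middle term, on lifted cochains.)
Ref: Neukirch–Schmidt–Wingberg (2008), I §3 (1.3.2); Serre, *Cohomologie galoisienne*, I §2.3.
[cite: NeukirchSchmidtWingberg2008, I §3 (1.3.2)] -/
theorem twoCocycleClass_eq_zero_iff (hι : ∀ (σ : Γ) (x : M), ι (ρ σ x) = π σ (ι x))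
    (hinj : Injective ι) {f : Γ → B} {c : contTwoCocycles ρ.toTopRep} (hc : IsCoboundaryLift π ι f c) :
    twoCocycleClass ρ.toTopRep c = 0 ↔
      ∃ h : C(Γ, M), ∀ σ τ, f (σ * τ) - ι (h (σ * τ)) = (f σ - ι (h σ)) + π σ (f τ - ι (h τ)) := by
  rw [_root_.Literature.NumberTheory.GaloisRepresentations.twoCocycleClass_eq_zero_iff]
  constructor
  · rintro ⟨b, hb⟩
    refine ⟨b, fun σ τ => ?_⟩
    have h1 := hc σ τ
    rw [hb σ τ, ContinuousRep.toTopRep_ρ_apply, map_add, map_sub, hι] at h1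
    rw [map_sub]
    -- `ι(σ b τ) - ι(b (στ)) + ι(b σ) = σ f τ - f (στ) + f σ`, rearranged
    linear_combination (norm := abel) h1
  · rintro ⟨h, hh⟩
    refine ⟨h, fun σ τ => hinj ?_⟩
    rw [hc σ τ, ContinuousRep.toTopRep_ρ_apply, map_add, map_sub, hι]
    have h1 := hh σ τ
    rw [map_sub] at h1
    linear_combination (norm := abel) -h1

/-- The same, with the conclusion packaged as a decomposition `f = ι ∘ h + z`, `h` continuous, `z` a
`1`-cocycle of `B`. [cite: NeukirchSchmidtWingberg2008, I §3 (1.3.2)] -/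
theorem exists_eq_comp_add_cocycle_of_twoCocycleClass_eq_zero
    (hι : ∀ (σ : Γ) (x : M), ι (ρ σ x) = π σ (ι x)) (hinj : Injective ι) {f : Γ → B}
    {c : contTwoCocycles ρ.toTopRep} (hc : IsCoboundaryLift π ι f c)
    (h0 : twoCocycleClass ρ.toTopRep c = 0) :
    ∃ (h : C(Γ, M)) (z : Γ → B), (∀ σ τ, z (σ * τ) = z σ + π σ (z τ)) ∧ ∀ σ, f σ = ι (h σ) + z σ := by
  obtain ⟨h, hh⟩ := (hc.twoCocycleClass_eq_zero_iff hι hinj).1 h0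
  exact ⟨h, fun σ => f σ - ι (h σ), hh, fun σ => by
    show f σ = ι (h σ) + (f σ - ι (h σ)); abel⟩

/-- Conversely a lift of the form `ι ∘ h + z` (`h` continuous, `z` a cocycle of `B`) presents a cocycle
with trivial class. [cite: NeukirchSchmidtWingberg2008, I §3 (1.3.2), II §7] -/
theorem twoCocycleClass_eq_zero_of_eq_comp_add_cocycle
    (hι : ∀ (σ : Γ) (x : M), ι (ρ σ x) = π σ (ι x)) (hinj : Injective ι) {f : Γ → B}
    {c : contTwoCocycles ρ.toTopRep} (hc : IsCoboundaryLift π ι f c) (h : C(Γ, M)) (z : Γ → B)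
    (hz : ∀ σ τ, z (σ * τ) = z σ + π σ (z τ)) (e : ∀ σ, f σ = ι (h σ) + z σ) :
    twoCocycleClass ρ.toTopRep c = 0 :=
  (hc.twoCocycleClass_eq_zero_iff hι hinj).2 ⟨h, fun σ τ => by
    rw [e, e, e, add_sub_cancel_left, add_sub_cancel_left, add_sub_cancel_left, hz]⟩

end Algebra

/-! ### Functoriality -/

section Functoriality

variable {R : Type*} [CommRing R] [TopologicalSpace R]
variable {Γ : Type u} [Group Γ] [TopologicalSpace Γ]
variable {M : Type u} [AddCommGroup M] [Module R M] [TopologicalSpace M] [IsTopologicalAddGroup M]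
  [ContinuousSMul R M]
variable {ρ : ContinuousRep Γ R M}
variable {S : Type*} [CommSemiring S] {B : Type*} [AddCommGroup B] [Module S B]
variable {π : Representation S Γ B} {ι : M →+ B}

/-- **Change of ambient module**: along an equivariant additive map `φ : B → B'` the cochain `φ ∘ f`
presents the same cocycle through `φ ∘ ι`. [cite: NeukirchSchmidtWingberg2008, I §3 (1.3.2), II §7] -/
theorem map {S' : Type*} [CommSemiring S'] {B' : Type*} [AddCommGroup B'] [Module S' B']
    {π' : Representation S' Γ B'} (φ : B →+ B') (hφ : ∀ (σ : Γ) (x : B), φ (π σ x) = π' σ (φ x))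
    {f : Γ → B} {c : contTwoCocycles ρ.toTopRep} (hc : IsCoboundaryLift π ι f c) :
    IsCoboundaryLift π' (φ.comp ι) (φ ∘ f) c := fun σ τ => by
  rw [AddMonoidHom.comp_apply, hc σ τ, map_add, map_sub, hφ]
  rfl

variable {Γ' : Type u} [Group Γ'] [TopologicalSpace Γ']
variable {M' : Type u} [AddCommGroup M'] [Module R M'] [TopologicalSpace M'] [IsTopologicalAddGroup M']
  [ContinuousSMul R M']
variable {ρ' : ContinuousRep Γ' R M'}

/-- **Pull-back along a compatible pair** `(θ : Γ' → Γ, φ : M|_θ → M')`: if `f` presents `c` through `ι`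
and `ι = ι' ∘ φ` for an additive `ι' : M' → B`, then `f ∘ θ` presents the pulled-back cocycle
`φ ∘ c ∘ (θ × θ)` (the tree's `contTwoCocycles.pullback`, whose class is `H²(θ, φ)[c]` by
`map_twoCocycleClass`) through `ι'`, for the restricted ambient action `π ∘ θ`. Covers restriction to a
subgroup (`φ = id`) and change of the small module (`θ = id`). [cite: SerreGaloisCohomology1997, I §2.4] -/
theorem pullback (θ : Γ' →ₜ* Γ) (φ : TopRep.res (θ : Γ' →* Γ) ρ.toTopRep ⟶ ρ'.toTopRep) (ι' : M' →+ B)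
    (hfac : ∀ x : M, ι' (φ.hom x) = ι x) {f : Γ → B} {c : contTwoCocycles ρ.toTopRep}
    (hc : IsCoboundaryLift π ι f c) :
    IsCoboundaryLift (π.comp (θ : Γ' →* Γ)) ι' (f ∘ θ) (contTwoCocycles.pullback θ φ c) := fun σ τ => by
  rw [contTwoCocycles.pullback_apply, hfac, hc, MonoidHom.comp_apply, comp_apply, comp_apply,
    comp_apply, map_mul]
  rfl

end Functoriality

/-! ### The quotient `B → C = B/ι(M)`: lifted cochains versus cocycles of the quotient -/

section Quotient

variable {R : Type*} [CommRing R] [TopologicalSpace R]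
variable {Γ : Type u} [Group Γ] [TopologicalSpace Γ]
variable {M : Type u} [AddCommGroup M] [Module R M] [TopologicalSpace M] [IsTopologicalAddGroup M]
  [ContinuousSMul R M]
variable {ρ : ContinuousRep Γ R M}
variable {S : Type*} [CommSemiring S] {B : Type*} [AddCommGroup B] [Module S B]
variable {π : Representation S Γ B} {ι : M →+ B}
variable {S'' : Type*} [CommSemiring S''] {C : Type*} [AddCommGroup C] [Module S'' C]
variable {πC : Representation S'' Γ C} {g : B →+ C}

omit [TopologicalSpace Γ] [TopologicalSpace M] [IsTopologicalAddGroup M] [ContinuousSMul R M] in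
/-- For an equivariant additive `g : B → C` with `ker g = ι(M)`: **`g ∘ f` is a crossed homomorphism of `C`
iff the coboundary of `f` lies in `ι(M)` pointwise.** [cite: NeukirchSchmidtWingberg2008, I §3 (1.3.2), II §7] -/
theorem _root_.Literature.NumberTheory.GaloisRepresentations.coboundary_mem_range_iff_comp_isCocycle
    (hg : ∀ (σ : Γ) (x : B), g (π σ x) = πC σ (g x))
    (hker : ∀ x : B, g x = 0 ↔ x ∈ Set.range ι) (f : Γ → B) :
    (∀ σ τ, π σ (f τ) - f (σ * τ) + f σ ∈ Set.range ι) ↔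
      ∀ σ τ, g (f (σ * τ)) = g (f σ) + πC σ (g (f τ)) := by
  refine forall_congr' fun σ => forall_congr' fun τ => ?_
  rw [← hker, map_add, map_sub, hg, sub_add_eq_add_sub, sub_eq_zero, eq_comm, add_comm]

omit [TopologicalSpace Γ] [TopologicalSpace M] [IsTopologicalAddGroup M] [ContinuousSMul R M] in
/-- If the push-forwards `g ∘ f`, `g ∘ f'` of two cochains are COHOMOLOGOUS crossed homomorphisms of `C`,
`g(f' σ) - g(f σ) = σ v - v` with `v = g b₀` (any `v` when `g` is onto), then
`f' - f - (σ b₀ - b₀)` takes values in `ι(M)` pointwise. (Continuity of the resulting `h : Γ → M` is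
then a matter of topology on `B`: `exists_continuousMap_comp_eq_of_isInducing`.) [cite: NeukirchSchmidtWingberg2008, I §3 (1.3.2), II §7] -/
theorem _root_.Literature.NumberTheory.GaloisRepresentations.exists_sub_sub_coboundary_mem_range
    (hg : ∀ (σ : Γ) (x : B), g (π σ x) = πC σ (g x))
    (hker : ∀ x : B, g x = 0 ↔ x ∈ Set.range ι) {f f' : Γ → B} {b₀ : B}
    (e : ∀ σ, g (f' σ) - g (f σ) = πC σ (g b₀) - g b₀) (σ : Γ) :
    f' σ - f σ - (π σ b₀ - b₀) ∈ Set.range ι := by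
  rw [← hker, map_sub, map_sub, map_sub, hg, e, sub_self]

end Quotient

/-! ### Topological supplement: continuity of `h` when `ι` is an embedding -/

section Topological

variable {R : Type*} [CommRing R] [TopologicalSpace R]
variable {Γ : Type u} [Group Γ] [TopologicalSpace Γ]
variable {M : Type u} [AddCommGroup M] [Module R M] [TopologicalSpace M] [IsTopologicalAddGroup M]
  [ContinuousSMul R M]
variable {ρ : ContinuousRep Γ R M}
variable {S : Type*} [CommSemiring S] {B : Type*} [AddCommGroup B] [Module S B] [TopologicalSpace B]
variable {π : Representation S Γ B} {ι : M →+ B}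

omit [Group Γ] [IsTopologicalAddGroup M] [ContinuousSMul R M] in
/-- **A continuous `B`-valued function with values in `ι(M)` is `ι ∘ h` with `h : Γ → M` continuous**,
when `ι` induces the topology of `M` (e.g. a closed embedding `ℚ_p(1) ↪ X`). [cite: NeukirchSchmidtWingberg2008, I §3 (1.3.2), II §7] -/
theorem _root_.Literature.NumberTheory.GaloisRepresentations.exists_continuousMap_comp_eq_of_isInducing
    (hind : IsInducing ι) {F : Γ → B} (hF : Continuous F) (hrange : ∀ σ, F σ ∈ Set.range ι) :
    ∃ h : C(Γ, M), ∀ σ, ι (h σ) = F σ := by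
  choose h hh using hrange
  have hcont : Continuous h := by
    rw [hind.continuous_iff]
    exact hF.congr fun σ => (hh σ).symm
  exact ⟨⟨h, hcont⟩, hh⟩

omit [TopologicalSpace Γ] [TopologicalSpace M] [IsTopologicalAddGroup M] [ContinuousSMul R M]
  [TopologicalSpace B] in
/-- Orbit maps are `1`-cocycles: `σ ↦ σ b₀ - b₀` satisfies `z(στ) = z(σ) + σ z(τ)`. [cite: NeukirchSchmidtWingberg2008, I §3 (1.3.2), II §7] -/
theorem _root_.Literature.NumberTheory.GaloisRepresentations.isCocycle_coboundary_of_representation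
    (π : Representation S Γ B) (b₀ : B) (σ τ : Γ) :
    π (σ * τ) b₀ - b₀ = (π σ b₀ - b₀) + π σ (π τ b₀ - b₀) := by
  rw [map_mul, Module.End.mul_apply, map_sub]; abel

variable [IsTopologicalGroup Γ] [LocallyCompactSpace Γ]

/-- ★ **Class equality for continuous lifts.** If `ι` is an equivariant embedding, `f`, `f'` present
`c`, `c'`, and `f' - f - z` is CONTINUOUS with values in `ι(M)` for some `1`-cocycle `z` of `B` (e.g.
`z = (σ ↦ σ b₀ - b₀)`, or `z = 0`), then `[c'] = [c]` in `H²_cont(Γ, M)`. For a topological extension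
`0 → M → B → C → 0` with `H¹`-lifts this is the well-definedness of `δ : H¹(Γ, C) → H²(Γ, M)` on liftable
classes. [cite: NeukirchSchmidtWingberg2008, I §3 (1.3.2) and II §7] -/
theorem twoCocycleClass_eq_of_continuous (hind : IsInducing ι)
    (hι : ∀ (σ : Γ) (x : M), ι (ρ σ x) = π σ (ι x)) (hinj : Injective ι) {f f' : Γ → B}
    {c c' : contTwoCocycles ρ.toTopRep} (hc : IsCoboundaryLift π ι f c)
    (hc' : IsCoboundaryLift π ι f' c') (z : Γ → B) (hz : ∀ σ τ, z (σ * τ) = z σ + π σ (z τ))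
    (hcont : Continuous fun σ => f' σ - f σ - z σ) (hrange : ∀ σ, f' σ - f σ - z σ ∈ Set.range ι) :
    twoCocycleClass ρ.toTopRep c' = twoCocycleClass ρ.toTopRep c := by
  obtain ⟨h, hh⟩ := exists_continuousMap_comp_eq_of_isInducing hind hcont hrange
  exact hc.twoCocycleClass_eq hι hinj hc' h z hz fun σ => by rw [hh]; abel

end Topological

end IsCoboundaryLift

end Literature.NumberTheory.GaloisRepresentations

end
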